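import Summits.BirchSwinnertonDyer.BirchSwinnertonDyer.Theorems.PrintCf2RubinValueTwoKatzMeasureJZeroIntegrandOfClassSums
import Literature.NumberTheory.EllipticCurves.DeShalit1987.LMeasureExistence
import HarnessLib

set_option linter.dupNamespace false
set_option autoImplicit false

/-!
# The (e)-ASSEMBLY, PACKAGING: the R3 endpoint `lMeasureJZero_classNumberOne_two` AS TYPED, from ONE supply — periods
# `(Ω, Ω₂)` once per frame, then for every `S` a tower, a bounded distribution, and the twisted class-sum identity

Cell `bsd-print-cf2`, width seat `bsd-line-cf2-p1-w3` g31; print leaf 24720 `KatzDistributionsAtTwoPrint` under director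
OPTION 1 (`j = 0` twin).  `--supports stmt-BirchSwinnertonDyer-24720` (helper, Theses-free).  THEOREMS ONLY (no `def`, no named
fact, no `sorry`); nothing is closed; no summit statement is proved by this seat; BSD is not proved by any of this.

WHAT.  The R3 endpoint (`Cruxes/KatzDistributionsAtTwoPrint/Lines/katz_measure_two_R3_endpoint.lean`, LEAD cf2-p1 g17; = the
planner's aside text `KatzDistributionsAtTwoJZeroClassOne` up to `katzDistributions₂₀_of_inlineLMeasures₀_classNumberOne 2`) is an
`∃ Ω δ Ωp … ∀ S … ∃ 𝒰 μ …` statement — the periods are chosen ONCE per frame `(K, ι, v, v̄)`, BEFORE the tame set `S`.  THIS FILE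
states the exact shape the measure lane must deliver and proves the endpoint from it:
**`lMeasureJZero_classNumberOne_two_of_seam`** — if for every frame there are `Ω ≠ 0` and `Ω₂ ∈ R₀ˣ` such that for every `S ∌ v, v̄`
there are a tower `𝒰` of open subgroups with `⋂ U_n ⊆ rayKer K 2 S` and a distribution `μ` along it with `‖μ‖ ≤ 1` satisfying the
twisted class-sum identity `hsum` of `…KatzMeasureJZeroIntegrandOfClassSums` (p763661) at `(Ω, Ω₂)`, then the R3 endpoint holds
VERBATIM (`δ := √d_K`; the integrand clause by `integral_avatar_eq_interpolationValue_of_twistedClassSums`).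
So the endpoint = [periods once] + [tower: -w5 CS round-robin chain ∘ A1 `iInter_diagonal_absRayAdicTower_subset_rayKer_of_finrank_eq_two`] +
[measure: -w8 G2′ in two stages, local datum fixed before `S`] + [hsum: H11 ∘ A9 ∘ MI ∘ bridge], and nothing else.

References: [deShalit1987] II.4.12 with Remarks (i), (iv) (p. 66–67), II.4.14 (36)–(40) (p. 71–73), II.4.16 (49)–(50) (p. 76–77).
-/

noncomputable section

open scoped NumberField Classical nonZeroDivisors
open NumberField IsDedekindDomain Field
open Literature Literature.NumberTheory.GaloisRepresentations Literature.NumberTheory.EllipticCurves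
open Literature.NumberTheory.LFunctions Literature.NumberTheory.NumberFields
open Literature.NumberTheory.EllipticCurves.DeShalit1987 Literature.NumberTheory.GaloisRepresentations.HeckeCharacter

namespace Summit.BirchSwinnertonDyer.BirchSwinnertonDyer.Theorems.PrintCf2.KatzMeasureJZeroTop

/-- ★★ **THE R3 ENDPOINT FROM ONE SUPPLY** (de Shalit II.4.14 at `p = 2`, `j = 0`, `m ≥ 3`, `h_K = 1`, in measure currency on `Γ_K`).
HYPOTHESIS `hsupply`: for every frame (`K` imaginary quadratic, `h_K = 1`, `ι : ℚ̄₂ ≃ ℂ`, `2 = v·v̄`, `ι ↔ v`) there are `Ω ≠ 0` and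
`Ω₂ ∈ R₀ˣ` such that for every finite `S ∌ v, v̄` there are a tower `𝒰` of OPEN subgroups of `Γ_K` with `⋂ U_n ⊆ rayKer K 2 S` and a
distribution `μ` along it with `‖μ‖ ≤ 1` for which the TWISTED CLASS-SUM IDENTITY holds (the `hsum` of p763661, at `Ωp := Ω₂`): a threshold
`M₁` such that for every infinite place `w₀`, `λ` of type `(1,0)` with module `(S ∪ {v̄}, M)`, `M ≥ M₁`, `𝔪_M ≠ (1)`, `w_{𝔪_M} = 1`, ray class
character `χ̃` mod `𝔪_M`, twist `𝔠 ≠ 0` prime to `𝔪_M v`, range character `ε` (relative avatar `e` outside `S`, `m ≥ 3`, type `(−m,0)`,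
unramified off `S ∪ {v̄}`, `ê` tower-continuous, `ε(ϖ_w) = χ̃(w)⁻¹λ̃(w)^{−m}` off `𝔪_M`, entire `L(ε,s)`) there are representatives `T` and
class lattices `L` with `(N𝔠 − ι⁻¹(χ̃(𝔠)λ̃(𝔠)^m))·∫ê dμ = ι⁻¹((1 − ε(ϖ_v)⁻¹2⁻¹)·Σ_{𝔟∈T} χ̃(𝔟)⁻¹λ̃(𝔟)^{−m}(N𝔠·E_m(Ω,L𝔟) − E_m(Ω,L(𝔠𝔟))))·Ω₂^m`.
CONCLUSION: the R3 endpoint `KatzMeasureTwo.lMeasureJZero_classNumberOne_two` VERBATIM.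
[cite: deShalit1987, II.4.12 Remarks (i), (iv) (p. 66–67), II.4.14 (36)–(40) (p. 71–73), II.4.16 (49)–(50) (p. 76–77)] -/
theorem lMeasureJZero_classNumberOne_two_of_seam
    (hsupply : ∀ (K : Type) [Field K] [NumberField K], IsImaginaryQuadratic K → NumberField.classNumber K = 1 →
      ∀ (ι : PadicAlgCl 2 ≃+* ℂ) (v vbar : HeightOneSpectrum (𝓞 K)),
        ((2 : ℕ) : 𝓞 K) ∈ v.asIdeal → ((2 : ℕ) : 𝓞 K) ∈ vbar.asIdeal → vbar ≠ v →
        (∀ (w : InfinitePlace K) (k : 𝓞 K), k ∈ v.asIdeal ↔ ‖ι.symm (w.embedding (k : K))‖ < 1) →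
      ∃ (Ω : ℂ) (Ωp : (unrIntegers 2)ˣ), Ω ≠ 0 ∧
        ∀ (S : Finset (HeightOneSpectrum (𝓞 K))), v ∉ S → vbar ∉ S →
          ∃ (𝒰 : SubgroupTower (absoluteGaloisGroup K)) (μ : GroupDistribution 𝒰 ℂ_[2]),
            (∀ n, IsOpen (𝒰.U n : Set (absoluteGaloisGroup K))) ∧
            (⋂ n, (𝒰.U n : Set (absoluteGaloisGroup K))) ⊆ DeShalit1987.rayKer K 2 S ∧
            μ.bound ≤ 1 ∧
            ∃ M₁ : ℕ, ∀ (w₀ : InfinitePlace K) (lam : HeckeCharacter K) (M : ℕ), M₁ ≤ M →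
              lam.HasInfinityType (fun _ ↦ 1) (fun _ ↦ 0) →
              lam.IsModulus (insert vbar S) (fun _ ↦ M) →
              modulusIdeal (insert vbar S) (fun _ ↦ M) ≠ ⊤ →
              (∀ u : (𝓞 K)ˣ, (u : 𝓞 K) - 1 ∈ modulusIdeal (insert vbar S) (fun _ ↦ M) → u = 1) →
              ∀ (χ : HeightOneSpectrum (𝓞 K) → ℂ), IsRayClassCharacter (modulusIdeal (insert vbar S) (fun _ ↦ M)) χ →
              ∀ (𝔠 : Ideal (𝓞 K)), 𝔠 ≠ ⊥ → IsCoprime 𝔠 (modulusIdeal (insert vbar S) (fun _ ↦ M)) →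
                IsCoprime 𝔠 v.asIdeal →
              ∀ (ε : HeckeCharacter K) (e : FramedGaloisRep K (PadicAlgCl 2) 1) (m : ℕ),
                IsPAdicAvatarOutside S ι ε e → 3 ≤ m →
                ε.HasInfinityType (fun _ ↦ -(m : ℤ)) (fun _ ↦ 0) →
                (∀ w : HeightOneSpectrum (𝓞 K), w ∉ S → w ≠ vbar → ε.IsUnramifiedAt w) →
                𝒰.IsTowerContinuous (fun σ ↦ avatarValueAt e σ) →
                (∀ w : HeightOneSpectrum (𝓞 K), ¬ modulusIdeal (insert vbar S) (fun _ ↦ M) ≤ w.asIdeal →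
                  ε.valueAtUniformizer w = (χ w)⁻¹ * (lam.valueAtUniformizer w ^ m)⁻¹) →
                ∀ hL : LFunction.HasEntireContinuation (heckeLFunction ε),
                ∃ (T : Finset (Ideal (𝓞 K))) (L : Ideal (𝓞 K) → PeriodPair),
                  IsRayClassReps (modulusIdeal (insert vbar S) (fun _ ↦ M)) T ∧
                  (∀ 𝔟 ∈ T, ∀ z : ℂ, z ∈ (L 𝔟).lattice ↔
                    ∃ x ∈ ((modulusIdeal (insert vbar S) (fun _ ↦ M) : FractionalIdeal (𝓞 K)⁰ K) /
                      (𝔟 : FractionalIdeal (𝓞 K)⁰ K)), z = Ω * w₀.embedding x) ∧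
                  (∀ 𝔟 ∈ T, ∀ z : ℂ, z ∈ (L (𝔠 * 𝔟)).lattice ↔
                    ∃ x ∈ ((modulusIdeal (insert vbar S) (fun _ ↦ M) : FractionalIdeal (𝓞 K)⁰ K) /
                      ((𝔠 * 𝔟 : Ideal (𝓞 K)) : FractionalIdeal (𝓞 K)⁰ K)), z = Ω * w₀.embedding x) ∧
                  ((Ideal.absNorm 𝔠 : ℂ_[2]) -
                      ((ι.symm (idealPow K χ 𝔠 * idealPow K (fun w ↦ lam.valueAtUniformizer w) 𝔠 ^ m) :
                        PadicAlgCl 2) : ℂ_[2])) * μ.integral (fun σ ↦ avatarValueAt e σ) =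
                    ((ι.symm ((1 - (ε.valueAtUniformizer v)⁻¹ * (((2 : ℕ) : ℂ))⁻¹) *
                        ∑ 𝔟 ∈ T, (idealPow K χ 𝔟)⁻¹ * (idealPow K (fun w ↦ lam.valueAtUniformizer w) 𝔟 ^ m)⁻¹ *
                          ((Ideal.absNorm 𝔠 : ℂ) * (L 𝔟).eisensteinE m Ω - (L (𝔠 * 𝔟)).eisensteinE m Ω)) :
                        PadicAlgCl 2) : ℂ_[2]) * ((Ωp : unrIntegers 2) : ℂ_[2]) ^ m) :
    ∀ (K : Type) [Field K] [NumberField K], IsImaginaryQuadratic K → NumberField.classNumber K = 1 →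
      ∀ (ι : PadicAlgCl 2 ≃+* ℂ) (v vbar : HeightOneSpectrum (𝓞 K)),
        ((2 : ℕ) : 𝓞 K) ∈ v.asIdeal → ((2 : ℕ) : 𝓞 K) ∈ vbar.asIdeal → vbar ≠ v →
        (∀ (w : InfinitePlace K) (k : 𝓞 K), k ∈ v.asIdeal ↔ ‖ι.symm (w.embedding (k : K))‖ < 1) →
      ∃ (Ω δ : ℂ) (Ωp : (unrIntegers 2)ˣ), Ω ≠ 0 ∧
        (δ ^ 2 = (NumberField.discr K : ℂ) ∨ δ ^ 2 = -(NumberField.discr K : ℂ)) ∧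
        ∀ (S : Finset (HeightOneSpectrum (𝓞 K))), v ∉ S → vbar ∉ S →
          ∃ (𝒰 : SubgroupTower (absoluteGaloisGroup K)) (μ : GroupDistribution 𝒰 ℂ_[2]),
            (∀ n, IsOpen (𝒰.U n : Set (absoluteGaloisGroup K))) ∧
            (⋂ n, (𝒰.U n : Set (absoluteGaloisGroup K))) ⊆ DeShalit1987.rayKer K 2 S ∧
            μ.bound ≤ 1 ∧
            ∀ (ε : HeckeCharacter K) (e : FramedGaloisRep K (PadicAlgCl 2) 1) (m : ℕ),
              IsPAdicAvatarOutside S ι ε e → 3 ≤ m →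
              ε.HasInfinityType (fun _ ↦ -(m : ℤ)) (fun _ ↦ ((0 : ℕ) : ℤ)) →
              (∀ w : HeightOneSpectrum (𝓞 K), w ∉ S → w ≠ vbar → ε.IsUnramifiedAt w) →
              𝒰.IsTowerContinuous (fun σ ↦ avatarValueAt e σ) →
              ∀ hL : LFunction.HasEntireContinuation (heckeLFunction ε),
                μ.integral (fun σ ↦ avatarValueAt e σ) =
                  ((ι.symm (DeShalit1987.interpolationValue 2 v vbar S ε m 0 Ω δ (hL.continuation 0)) :
                      PadicAlgCl 2) : ℂ_[2]) * ((Ωp : unrIntegers 2) : ℂ_[2]) ^ (m + 0) := by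
  intro K _ _ hK hh ι v vbar hv hvbar hne hι
  obtain ⟨Ω, Ωp, hΩ, hS⟩ := hsupply K hK hh ι v vbar hv hvbar hne hι
  obtain ⟨δ, hδ⟩ := IsAlgClosed.exists_pow_nat_eq (NumberField.discr K : ℂ) two_pos
  refine ⟨Ω, δ, Ωp, hΩ, Or.inl hδ, fun S hvS hvbarS ↦ ?_⟩
  obtain ⟨𝒰, μ, hopen, hray, hbd, hsum⟩ := hS S hvS hvbarS
  exact ⟨𝒰, μ, hopen, hray, hbd, fun ε e m he hm hε hεu hcont hL ↦
    integral_avatar_eq_interpolationValue_of_twistedClassSums hK hh ι hv hvbar hne hvS hΩ δ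
      ((Ωp : unrIntegers 2) : ℂ_[2]) μ hsum ε e m he hm hε hεu hcont hL⟩

end Summit.BirchSwinnertonDyer.BirchSwinnertonDyer.Theorems.PrintCf2.KatzMeasureJZeroTop

end
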